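import Summits.CriticalPhenomena.PercolationContinuityZ3.Theorems.Transplant.SkelFrmBChoiceRootReadWidthY
import Summits.CriticalPhenomena.PercolationContinuityZ3.Theorems.Transplant.SkelFrmBChoiceArrivalYW
import HarnessLib

/-!
# N2 (frames-only node `SamePDropOfSkeletonFrm₁`, OPEN) — (ζ″) ledger, (R) column input (p3-g18 asks 2026-08-23T15:56:57Z/16:24:36Z): **THE ROOT READING ROWS,
# SECOND AXIS, ARRIVAL (R-YA)** (part 2; part 1 = SkelFrmBChoiceRootReadWidthY) — the y′ ROOT corridor's last core, in the (C) y′ arrival box `[arrLoY3, arrHiY3]`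
# (SkelFrmBChoiceCreepY3) WIDENED by `(2n_L, sL | n_L, 1)` (p3-g18's `KS.yLast_mem_box` / `rootBoxY_across/bottom/top_R`), reads inside `TargetFoot (1,true)` at
# the window of record `small3` and the creep of record `cRvY3`: `c1 − b₀ + 1 ≤ rdLo₀ ∧ rdHi₀ ≤ c1 + b₀ − 1 ∧ 20r₁ − b₁ + 1 ≤ rdLo₁ ∧ rdHi₁ ≤ 20r₁ + b₁ − 1`

The across rows come from part 1 (width `≤ 95·s₀ − 1`, shift lemmas with `c₀'·A·Δ = s₀·D` (`hsc_Q.1`, `r₀ = 40kq·s₀`) and the shear spread `|v|·U·sL ≤ n·Δ`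
(`v_le`, `UsL_le_modulus`): `3·s₀` down for `(2n_L | sL)`, `2·s₀` up for `(n_L | 1)`); the rows (axis 1) from the widened twin of `arrivalY_coreW` (§4, true slack
`≈ 17·s₁`, the widening costs `s₁ + 1`).  Margins at the instance of record `(76·s₀, 19·s₁)`: across `c1 − 76·s₀ + 1 ≤ (c1 − 48·s₀) − 3·s₀`,
`… + 2·s₀ ≤ c1 + 76·s₀ − 1` (≈ 25·s₀ spare); rows ≈ 14·s₁ spare.
* §4 `arrivalY_core_wide`; §5 `rootReadYA_rows`, `rootReadYA_across`, **`rootReadYA_Q`** (`c1 := cRvY3 mk`, `b := small3`; the `KS.RowYA` spelling with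
  `(fcellsT … (cR2vW … mk)).c 1` is `rootReadYA_QT` in SkelFrmBChoiceRootReadRows).
NON-VACUITY (lead g11 standing order 03:52:56Z): value rows at the closed tuple; binder set = `hLtY_3`'s / `hLlY_W`'s (`hKq`, `hN`, `hg`, `hg2`).
builds on p205010 (kernel theorem, internal audit signed; external expert review pending) — nothing in this file uses p205010; NOTHING is claimed about the open
node `SamePDropOfSkeletonFrm₁`.
Lane `prim-bschramm`, seat `prim-bschramm-stmt` (gen 22); helper file (`--supports stmt-CriticalPhenomena-4575 --as helper`).
[cite: KozmaNitzan2024, §4 p. 28 ((32) at the root), Lemma 12 (pp. 23–25)] [cite: MartineauTassion2017, §4.1, §4.3 Lemma 4.2]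
-/

open scoped Classical

noncomputable section

namespace Summit.CriticalPhenomena.PercolationContinuityZ3.Theorems.Transplant

namespace PlanarSkeletonFrm

namespace NegB

open Literature.Probability.Percolation Literature.Probability.LatticeModels SimpleGraph
open Literature.Probability.Percolation.KozmaNitzan.Cells (oth)
open SkelConc (Consts)
open Skelφ (shearUnit kgSL kgSLY kgM₁Y kgM₂Y kgE₁Y kgXY kgCtr2Y kgHw2Y kgA₁Yp kgT₁Y kgTY kgDec₁Y kgDec₂Y dS rdLo rdHi KGYRows)
open TwoAxis.Para (modulus)
open Neg

/-! ## §4 The pure-integer core of the y′ arrival rows, widened rows -/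

/-- **The y′ arrival's fine-1 rows for the box widened by `(s | 1)` in rows** (twin of `arrivalY_coreW`, SkelFrmBChoiceArrivalYW, whose true slack is `≈ 17·s₁`:
the extra `−s` below costs `≤ s₁ + 1`, the `+1` above `< 1`). [folklore] -/
theorem arrivalY_core_wide {U Δ s K R P₀ pY tgt hi₁ lo₁ s₁ Flo Fhi : ℤ}
    (hU : 1 ≤ U) (hUs : U * s ≤ Δ) (hs : 958 ≤ s) (hK : 40 ≤ K) (hR : 1 ≤ R) (hKR : 40 * K * R ≤ s + 1)
    (hP1 : P₀ ≤ s + 1)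
    (hpy1 : U * pY ≤ 20 * K * Δ) (hpy2 : 20 * K * Δ < U * pY + U)
    (ht1 : 2 * pY + P₀ + s + 3 * R ≤ 2 * tgt) (ht2 : 2 * tgt ≤ 2 * pY + P₀ + s + 3 * R + 2)
    (hfar : hi₁ ≤ tgt) (htgt : tgt < hi₁ + s + (3 * R + 2)) (hlo : lo₁ = hi₁ - P₀)
    (hs1 : 1 ≤ s₁) (hFlo' : s₁ * (U * (lo₁ - s)) < Δ * Flo + Δ) (hFhi : Δ * Fhi ≤ s₁ * (U * (hi₁ + 1) + U - 1)) :
    20 * (K * s₁) - 19 * s₁ + 1 ≤ Flo ∧ Fhi + 1 ≤ 20 * (K * s₁) + 19 * s₁ - 1 := by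
  have hU0 : 0 < U := by linarith
  have hU958 : 958 * U ≤ Δ := by have := mul_le_mul_of_nonneg_left hs hU0.le; linarith
  have hΔ0 : 0 < Δ := by linarith
  have hs1p : 0 < s₁ := by linarith
  have hUR0 : 0 ≤ U * R := by positivity
  have hUR : 40 * K * (U * R) ≤ Δ + U := by
    have := mul_le_mul_of_nonneg_left hKR hU0.le
    calc 40 * K * (U * R) = U * (40 * K * R) := by ring
      _ ≤ U * (s + 1) := this
      _ = U * s + U := by ring
      _ ≤ Δ + U := by linarith
  have h1600 : 1600 * (U * R) ≤ 40 * K * (U * R) := mul_le_mul_of_nonneg_right (by linarith) hUR0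
  have hKs1 : 40 * s₁ ≤ K * s₁ := mul_le_mul_of_nonneg_right hK hs1p.le
  -- lower chain (rows lowered by `s`: `2U(lo₁ − s) ≥ 40KΔ − 4Δ − 3UR − 7U`)
  have h2lo : 2 * pY - 2 * s - 3 * R - 5 ≤ 2 * lo₁ := by rw [hlo]; linarith
  have h2Ulo : 40 * K * Δ - 4 * Δ - 3 * (U * R) - 7 * U ≤ 2 * (U * (lo₁ - s)) := by
    have a := mul_le_mul_of_nonneg_left h2lo hU0.le
    have e1 : U * (2 * pY - 2 * s - 3 * R - 5) = 2 * (U * pY) - 2 * (U * s) - 3 * (U * R) - 5 * U := by ring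
    have e2 : 2 * (U * (lo₁ - s)) = U * (2 * lo₁) - 2 * (U * s) := by ring
    linarith
  have hb := mul_le_mul_of_nonneg_left h2Ulo hs1p.le
  have hX : 2 * Δ ≤ 34 * Δ - 3 * (U * R) - 7 * U := by linarith
  have hX1 : 1 * (34 * Δ - 3 * (U * R) - 7 * U) ≤ s₁ * (34 * Δ - 3 * (U * R) - 7 * U) := mul_le_mul_of_nonneg_right hs1 (by linarith)
  have klo : Δ * (20 * (K * s₁) - 19 * s₁) < Δ * Flo := by
    have e3 : s₁ * (40 * K * Δ - 4 * Δ - 3 * (U * R) - 7 * U) = 40 * (Δ * (K * s₁)) - 4 * (Δ * s₁) - 3 * (s₁ * (U * R)) - 7 * (s₁ * U) := by ring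
    have e4 : s₁ * (2 * (U * (lo₁ - s))) = 2 * (s₁ * (U * (lo₁ - s))) := by ring
    have e5 : s₁ * (34 * Δ - 3 * (U * R) - 7 * U) = 34 * (Δ * s₁) - 3 * (s₁ * (U * R)) - 7 * (s₁ * U) := by ring
    have e6 : Δ * (20 * (K * s₁) - 19 * s₁) = 20 * (Δ * (K * s₁)) - 19 * (Δ * s₁) := by ring
    linarith
  have hlo1 := lt_of_mul_lt_mul_left klo hΔ0.le
  -- upper chain (rows raised by `1`: `2U(hi₁ + 1) + 2U − 2 ≤ 40KΔ + 2Δ + 3UR + 7U − 2`)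
  have h2hi : 2 * hi₁ ≤ 2 * pY + 2 * s + 3 * R + 3 := by linarith
  have h2Uhi : 2 * (U * (hi₁ + 1)) + 2 * U - 2 ≤ 40 * K * Δ + 2 * Δ + 3 * (U * R) + 7 * U - 2 := by
    have a := mul_le_mul_of_nonneg_left h2hi hU0.le
    have e1 : U * (2 * pY + 2 * s + 3 * R + 3) = 2 * (U * pY) + 2 * (U * s) + 3 * (U * R) + 3 * U := by ring
    have e2 : 2 * (U * (hi₁ + 1)) = U * (2 * hi₁) + 2 * U := by ring
    linarith
  have hc := mul_le_mul_of_nonneg_left h2Uhi hs1p.le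
  have khi : Δ * Fhi < Δ * (20 * (K * s₁) + 19 * s₁ - 1) := by
    have e3 : s₁ * (40 * K * Δ + 2 * Δ + 3 * (U * R) + 7 * U - 2) = 40 * (Δ * (K * s₁)) + 2 * (Δ * s₁) + 3 * (s₁ * (U * R)) + 7 * (s₁ * U) - 2 * s₁ := by ring
    have e4 : s₁ * (2 * (U * (hi₁ + 1)) + 2 * U - 2) = 2 * (s₁ * (U * (hi₁ + 1) + U - 1)) := by ring
    have e5 : s₁ * (34 * Δ - 3 * (U * R) - 7 * U) = 34 * (Δ * s₁) - 3 * (s₁ * (U * R)) - 7 * (s₁ * U) := by ring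
    have e6 : Δ * (20 * (K * s₁) + 19 * s₁ - 1) = 20 * (Δ * (K * s₁)) + 19 * (Δ * s₁) - Δ := by ring
    have hsU : 0 ≤ s₁ * U := by positivity
    have hΔs : Δ ≤ Δ * s₁ := le_mul_of_one_le_right hΔ0.le hs1
    linarith
  have hhi1 := lt_of_mul_lt_mul_left khi hΔ0.le
  exact ⟨by linarith, by linarith⟩

/-! ## §5 (R-YA) at the tuple of record -/

section RootYA

variable (κ : Consts) {V : Type} [DecidableEq V] [Countable V] {G : SimpleGraph V} [G.LocallyFinite] (Φ : PlanarSkeletonFrm G) (t : V) (p : unitInterval)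
  (D : Skelφ.StepI.DataNS V) (g f mk : ℕ)

/-- **(R-YA), ROWS (axis 1)**: the (C) y′ arrival box widened by `(s | 1)` in rows reads `20r₁ − b₁ + 1 ≤ rdLo₁ ∧ rdHi₁ ≤ 20r₁ + b₁ − 1` (`b₁ = 19·s₁`; any axis-0
corners). [this work] -/
theorem rootReadYA_rows (hKq : 5 ≤ Neg.Kq κ) (hN : EqNumL κ Φ t p D g f) (hg : gFloorKG κ Φ t p D mk ≤ g) (hg2 : 40 * Neg.K κ * KS0.R'0 κ Φ t p D mk ≤ g) :
    20 * (((fcellsA κ Φ t p D g f).r 1 : ℕ) : ℤ) - ((BSlot.small3 κ Φ t p D g f 1 : ℕ) : ℤ) + 1 ≤ rdLo (Aof κ) (nL κ Φ t p D g f) (hL κ Φ t p D g f) (vL κ Φ t p D g f) (vβL κ Φ t p D g f) (prFA κ Φ t p D g f).c₀ (prFA κ Φ t p D g f).c₁ (prFA κ Φ t p D g f).D (![arrLoY3 κ Φ t p D g f mk 0 - 2 * (nL κ Φ t p D g f : ℤ), arrLoY3 κ Φ t p D g f mk 1 - kgSL (nL κ Φ t p D g f) (ℓL κ Φ t p D g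 f) (hL κ Φ t p D g f)] : Site 2) (![arrHiY3 κ Φ t p D g f mk 0 + (nL κ Φ t p D g f : ℤ), arrHiY3 κ Φ t p D g f mk 1 + 1] : Site 2) 1 ∧ rdHi (Aof κ) (nL κ Φ t p D g f) (hL κ Φ t p D g f) (vL κ Φ t p D g f) (vβL κ Φ t p D g f) (prFA κ Φ t p D g f).c₀ (prFA κ Φ t p D g f).c₁ (prFA κ Φ t p D g f).D (![arrLoY3 κ Φ t p D g f mk 0 - 2 * (nL κ Φ t p D g f : ℤ), arrLoY3 κ Φ t p D g f mk 1 - kgSL (nL κ Φ t p D g f) (ℓL κ Φ t p D g f) (hL κ Φ t p D g f)] : Site 2) (![arrHiY3 κ Φ t p D g f mk 0 + (nL κ Φ t p D g f : ℤ), arrHiY3 κ Φ t p D g f mk 1 + 1] : Site 2) 1 ≤ 20 * (((fcellsA κ Φ t p D g f).r 1 : ℕ) : ℤ) + ((BSlot.small3 κ Φ t p D g f 1 : ℕ) : ℤ) - 1 := by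
  obtain ⟨-, hsc1, hn1, -, hDp, hm, -, -, hkq, -⟩ := hsc_Q κ Φ t p D g f hN
  obtain ⟨-, hs40, hbig, hR1, hK40, -⟩ := valsQ_floor κ Φ t p D g f mk hN hg hg2
  have hUs := UsL_le_modulus κ Φ t p D g f hN
  obtain ⟨hpy1, hpy2⟩ := pitchY_floor_W κ Φ t p D g f hN
  obtain ⟨ht1, ht2⟩ := tgtY0_two_mul_W κ Φ t p D g f mk
  obtain ⟨hfar, htgt⟩ := farY_spec_W κ Φ t p D g f mk hKq hN hg hg2
  have hP1 := Skelφ.natDiv_le_kgSLY hn1 (ℓL κ Φ t p D g f) (hL κ Φ t p D g f)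
  rw [kgSLY_eq_kgSL] at hP1
  have hP0nat : (((nL κ Φ t p D g f) * (ℓL κ Φ t p D g f) / (shearUnit (nL κ Φ t p D g f) (hL κ Φ t p D g f)) : ℕ) : ℤ) = (((nL κ Φ t p D g f) : ℕ) : ℤ) * (ℓL κ Φ t p D g f) / ((shearUnit (nL κ Φ t p D g f) (hL κ Φ t p D g f)) : ℕ) := by push_cast; rfl
  have hRR : ((KS0.R'0 κ Φ t p D mk : ℕ) : ℤ) = (((kgR κ Φ t p D mk) : ℕ) : ℤ) := rfl
  rw [hRR] at hs40 hR1
  have hU : (0 : ℤ) < ((shearUnit (nL κ Φ t p D g f) (hL κ Φ t p D g f)) : ℕ) := Skelφ.shearUnit_pos hn1 _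
  have hU1 : (1 : ℤ) ≤ ((shearUnit (nL κ Φ t p D g f) (hL κ Φ t p D g f)) : ℕ) := by linarith
  have hs1one : (1 : ℤ) ≤ ((((fcellsA κ Φ t p D g f).s 1 : ℕ) : ℤ)) := by exact_mod_cast (fcellsA κ Φ t p D g f).hs 1
  -- the box rows
  obtain ⟨-, -, elo1, ehi1⟩ := arrY3_apply κ Φ t p D g f mk
  rw [kgSLY_eq_kgSL] at elo1 ehi1
  have hlo : arrLoY3 κ Φ t p D g f mk 1 = arrHiY3 κ Φ t p D g f mk 1 - (((nL κ Φ t p D g f) * (ℓL κ Φ t p D g f) / (shearUnit (nL κ Φ t p D g f) (hL κ Φ t p D g f)) : ℕ) : ℤ) := by rw [elo1, ehi1, hP0nat]; push_cast; ring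
  rw [← ehi1] at hfar htgt
  -- the fine-1 reading is `⌊s₁·X/Δ⌋`
  have hr1 : ((((fcellsA κ Φ t p D g f).r 1 : ℕ) : ℤ)) = 40 * ((Neg.Kq κ : ℕ) : ℤ) * ((((fcellsA κ Φ t p D g f).s 1 : ℕ) : ℤ)) := by
    rw [PCells2.r_eq, show ((fcellsA κ Φ t p D g f).K : ℤ) = Neg.K κ by exact_mod_cast (fcellsA_K κ Φ t p D g f).1,
      show (Neg.K κ : ℤ) = 40 * ((Neg.Kq κ : ℕ) : ℤ) by exact_mod_cast Neg.K_eq κ]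
  have hr1K : ((((fcellsA κ Φ t p D g f).r 1 : ℕ) : ℤ)) = (((Neg.K κ : ℕ) : ℤ)) * ((((fcellsA κ Φ t p D g f).s 1 : ℕ) : ℤ)) := by rw [PCells2.r_eq, show ((fcellsA κ Φ t p D g f).K : ℤ) = Neg.K κ by exact_mod_cast (fcellsA_K κ Φ t p D g f).1]
  have hb1 : ((BSlot.small3 κ Φ t p D g f 1 : ℕ) : ℤ) = 19 * ((((fcellsA κ Φ t p D g f).s 1 : ℕ) : ℤ)) := by rw [(small3_eq κ Φ t p D g f).2]; push_cast; ring
  have hkq' : (0 : ℤ) < ((Neg.Kq κ : ℕ) : ℤ) := by exact_mod_cast hkq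
  have hsc1' : (prFA κ Φ t p D g f).c₁ * Aof κ * (40 * ((Neg.Kq κ : ℕ) : ℤ) * (modulus (nL κ Φ t p D g f) (hL κ Φ t p D g f) (vL κ Φ t p D g f) (vβL κ Φ t p D g f))) = 40 * ((Neg.Kq κ : ℕ) : ℤ) * ((((fcellsA κ Φ t p D g f).s 1 : ℕ) : ℤ)) * (prFA κ Φ t p D g f).D := by rw [hsc1, hr1]
  rw [Skelφ.rdLo_one, Skelφ.rdHi_one]
  simp only [Matrix.cons_val_one, Matrix.cons_val_zero]
  rw [rd1_div_eq (X := _) hDp hkq' hm hsc1', rd1_div_eq (X := _) hDp hkq' hm hsc1', hr1K, hb1]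
  have hFlo' := Int.lt_mul_ediv_self_add (x := ((((fcellsA κ Φ t p D g f).s 1 : ℕ) : ℤ)) * ((((shearUnit (nL κ Φ t p D g f) (hL κ Φ t p D g f)) : ℕ) : ℤ) * (arrLoY3 κ Φ t p D g f mk 1 - kgSL (nL κ Φ t p D g f) (ℓL κ Φ t p D g f) (hL κ Φ t p D g f)))) hm
  have hFhi := Int.mul_ediv_self_le (x := ((((fcellsA κ Φ t p D g f).s 1 : ℕ) : ℤ)) * ((((shearUnit (nL κ Φ t p D g f) (hL κ Φ t p D g f)) : ℕ) : ℤ) * (arrHiY3 κ Φ t p D g f mk 1 + 1) + (((shearUnit (nL κ Φ t p D g f) (hL κ Φ t p D g f)) : ℕ) : ℤ) - 1)) (ne_of_gt hm)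
  exact arrivalY_core_wide (hU := hU1) (hUs := hUs) (hs := hbig) (hK := hK40) (hR := hR1) (hKR := hs40) (hP1 := hP1) (hpy1 := hpy1) (hpy2 := hpy2)
    (ht1 := ht1) (ht2 := ht2) (hfar := hfar) (htgt := htgt) (hlo := hlo) (hs1 := hs1one) (hFlo' := hFlo') (hFhi := hFhi)

/-- **(R-YA), ACROSS (axis 0)**: the (C) y′ arrival box widened by `(2n_L | n_L)` along x and `(s | 1)` in rows reads `c1 − b₀ + 1 ≤ rdLo₀ ∧ rdHi₀ ≤ c1 + b₀ − 1`
(`c1 = cRvY3` = the midpoint of the unwidened box's x-reading, whose width is `≤ 95·s₀ − 1` (`rd0Y_width_3`); the widening moves the readings by `3·s₀` down /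
`2·s₀` up (`rdLo_zero_widen`/`rdHi_zero_widen` with `c₀'·A·Δ = s₀·D`, `|v|·U·sL ≤ n·Δ`); `b₀ = 76·s₀`). [this work] -/
theorem rootReadYA_across (hKq : 5 ≤ Neg.Kq κ) (hN : EqNumL κ Φ t p D g f) (hg : gFloorKG κ Φ t p D mk ≤ g) (hg2 : 40 * Neg.K κ * KS0.R'0 κ Φ t p D mk ≤ g) :
    ((cRvY3 κ Φ t p D g f mk : ℕ) : ℤ) - ((BSlot.small3 κ Φ t p D g f 0 : ℕ) : ℤ) + 1 ≤ rdLo (Aof κ) (nL κ Φ t p D g f) (hL κ Φ t p D g f) (vL κ Φ t p D g f) (vβL κ Φ t p D g f) (prFA κ Φ t p D g f).c₀ (prFA κ Φ t p D g f).c₁ (prFA κ Φ t p D g f).D (![arrLoY3 κ Φ t p D g f mk 0 - 2 * (nL κ Φ t p D g f : ℤ), arrLoY3 κ Φ t p D g f mk 1 - kgSL (nL κ Φ t p D g f) (ℓL κ Φ t p D g f) (hL κ Φ t p D g f)] : Site 2) (![arrHiY3 κ Φ t p D g f mk 0 + (nL κ Φ t p D g f : ℤ), arrHiY3 κ Φ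 t p D g f mk 1 + 1] : Site 2) 0 ∧ rdHi (Aof κ) (nL κ Φ t p D g f) (hL κ Φ t p D g f) (vL κ Φ t p D g f) (vβL κ Φ t p D g f) (prFA κ Φ t p D g f).c₀ (prFA κ Φ t p D g f).c₁ (prFA κ Φ t p D g f).D (![arrLoY3 κ Φ t p D g f mk 0 - 2 * (nL κ Φ t p D g f : ℤ), arrLoY3 κ Φ t p D g f mk 1 - kgSL (nL κ Φ t p D g f) (ℓL κ Φ t p D g f) (hL κ Φ t p D g f)] : Site 2) (![arrHiY3 κ Φ t p D g f mk 0 + (nL κ Φ t p D g f : ℤ), arrHiY3 κ Φ t p D g f mk 1 + 1] : Site 2) 0 ≤ ((cRvY3 κ Φ t p D g f mk : ℕ) : ℤ) + ((BSlot.small3 κ Φ t p D g f 0 : ℕ) : ℤ) - 1 := by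
  obtain ⟨hsc0, -, hn1, hA0, hDp, hm, hc₀, -, hkq, -⟩ := hsc_Q κ Φ t p D g f hN
  obtain ⟨-, -, hbig, -, -, -⟩ := valsQ_floor κ Φ t p D g f mk hN hg hg2
  have hUs := UsL_le_modulus κ Φ t p D g f hN
  have hv := hN.v_le
  obtain ⟨-, hsum, -, -, -⟩ := rd0Y_bounds_3 κ Φ t p D g f mk hKq hN hg hg2
  have hw := rd0Y_width_3 κ Φ t p D g f mk hKq hN hg hg2
  obtain ⟨hc, -⟩ := cRvY3_eq κ Φ t p D g f mk hKq hN hg hg2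
  have hb0 : ((BSlot.small3 κ Φ t p D g f 0 : ℕ) : ℤ) = 76 * (((fcellsA κ Φ t p D g f).s 0 : ℕ) : ℤ) := by rw [(small3_eq κ Φ t p D g f).1]; push_cast; ring
  have hs0one : (1 : ℤ) ≤ (((fcellsA κ Φ t p D g f).s 0 : ℕ) : ℤ) := by exact_mod_cast (fcellsA κ Φ t p D g f).hs 0
  -- `c₀'·A·Δ = s₀·D`
  have hr0 : (((fcellsA κ Φ t p D g f).r 0 : ℕ) : ℤ) = 40 * ((Neg.Kq κ : ℕ) : ℤ) * (((fcellsA κ Φ t p D g f).s 0 : ℕ) : ℤ) := by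
    rw [PCells2.r_eq, show ((fcellsA κ Φ t p D g f).K : ℤ) = Neg.K κ by exact_mod_cast (fcellsA_K κ Φ t p D g f).1,
      show (Neg.K κ : ℤ) = 40 * ((Neg.Kq κ : ℕ) : ℤ) by exact_mod_cast Neg.K_eq κ]
  have e0 : (prFA κ Φ t p D g f).c₀ * Aof κ * modulus (nL κ Φ t p D g f) (hL κ Φ t p D g f) (vL κ Φ t p D g f) (vβL κ Φ t p D g f) = (((fcellsA κ Φ t p D g f).s 0 : ℕ) : ℤ) * (prFA κ Φ t p D g f).D := by
    rw [hr0] at hsc0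
    have h' : (40 * ((Neg.Kq κ : ℕ) : ℤ)) * ((prFA κ Φ t p D g f).c₀ * Aof κ * modulus (nL κ Φ t p D g f) (hL κ Φ t p D g f) (vL κ Φ t p D g f) (vβL κ Φ t p D g f)) = (40 * ((Neg.Kq κ : ℕ) : ℤ)) * ((((fcellsA κ Φ t p D g f).s 0 : ℕ) : ℤ) * (prFA κ Φ t p D g f).D) := by
      linear_combination hsc0
    have h40 : (40 * ((Neg.Kq κ : ℕ) : ℤ)) ≠ 0 := by positivity
    exact mul_left_cancel₀ h40 h'
  -- the shear spread of the extra rows: `|v|·U·sL ≤ n·Δ`, `|v|·U ≤ n·Δ`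
  have hU0 : (0 : ℤ) ≤ ((shearUnit (nL κ Φ t p D g f) (hL κ Φ t p D g f) : ℕ) : ℤ) := by positivity
  have hn0 : (0 : ℤ) ≤ (nL κ Φ t p D g f : ℤ) := by positivity
  have hs0 : (0 : ℤ) ≤ kgSL (nL κ Φ t p D g f) (ℓL κ Φ t p D g f) (hL κ Φ t p D g f) := by linarith
  have hvUs : |vL κ Φ t p D g f| * (((shearUnit (nL κ Φ t p D g f) (hL κ Φ t p D g f) : ℕ) : ℤ) * kgSL (nL κ Φ t p D g f) (ℓL κ Φ t p D g f) (hL κ Φ t p D g f)) ≤ (nL κ Φ t p D g f : ℤ) * modulus (nL κ Φ t p D g f) (hL κ Φ t p D g f) (vL κ Φ t p D g f) (vβL κ Φ t p D g f) :=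
    calc |vL κ Φ t p D g f| * (((shearUnit (nL κ Φ t p D g f) (hL κ Φ t p D g f) : ℕ) : ℤ) * kgSL (nL κ Φ t p D g f) (ℓL κ Φ t p D g f) (hL κ Φ t p D g f)) ≤ (nL κ Φ t p D g f : ℤ) * (((shearUnit (nL κ Φ t p D g f) (hL κ Φ t p D g f) : ℕ) : ℤ) * kgSL (nL κ Φ t p D g f) (ℓL κ Φ t p D g f) (hL κ Φ t p D g f)) := mul_le_mul_of_nonneg_right hv (mul_nonneg hU0 hs0)
      _ ≤ (nL κ Φ t p D g f : ℤ) * modulus (nL κ Φ t p D g f) (hL κ Φ t p D g f) (vL κ Φ t p D g f) (vβL κ Φ t p D g f) := mul_le_mul_of_nonneg_left hUs hn0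
  have hUΔ : ((shearUnit (nL κ Φ t p D g f) (hL κ Φ t p D g f) : ℕ) : ℤ) ≤ modulus (nL κ Φ t p D g f) (hL κ Φ t p D g f) (vL κ Φ t p D g f) (vβL κ Φ t p D g f) := le_trans (le_mul_of_one_le_right hU0 (by linarith)) hUs
  have hvU : |vL κ Φ t p D g f| * ((shearUnit (nL κ Φ t p D g f) (hL κ Φ t p D g f) : ℕ) : ℤ) ≤ (nL κ Φ t p D g f : ℤ) * modulus (nL κ Φ t p D g f) (hL κ Φ t p D g f) (vL κ Φ t p D g f) (vβL κ Φ t p D g f) :=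
    calc |vL κ Φ t p D g f| * ((shearUnit (nL κ Φ t p D g f) (hL κ Φ t p D g f) : ℕ) : ℤ) ≤ (nL κ Φ t p D g f : ℤ) * ((shearUnit (nL κ Φ t p D g f) (hL κ Φ t p D g f) : ℕ) : ℤ) := mul_le_mul_of_nonneg_right hv hU0
      _ ≤ (nL κ Φ t p D g f : ℤ) * modulus (nL κ Φ t p D g f) (hL κ Φ t p D g f) (vL κ Φ t p D g f) (vβL κ Φ t p D g f) := mul_le_mul_of_nonneg_left hUΔ hn0
  have hT1 : vL κ Φ t p D g f * (((shearUnit (nL κ Φ t p D g f) (hL κ Φ t p D g f) : ℕ) : ℤ) * (arrLoY3 κ Φ t p D g f mk 1 - kgSL (nL κ Φ t p D g f) (ℓL κ Φ t p D g f) (hL κ Φ t p D g f))) ≤ max (vL κ Φ t p D g f * (((shearUnit (nL κ Φ t p D g f) (hL κ Φ t p D g f) : ℕ) : ℤ) * arrLoY3 κ Φ t p D g f mk 1)) (vL κ Φ t p D g f * (((shearUnit (nL κ Φ t p D g f) (hL κ Φ t p D g f) : ℕ) : ℤ) * arrHiY3 κ Φ t p D g f mk 1 + ((shearUnit (nL κ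 Φ t p D g f) (hL κ Φ t p D g f) : ℕ) : ℤ) - 1)) + (nL κ Φ t p D g f : ℤ) * modulus (nL κ Φ t p D g f) (hL κ Φ t p D g f) (vL κ Φ t p D g f) (vβL κ Φ t p D g f) := by
    have e1 : vL κ Φ t p D g f * (((shearUnit (nL κ Φ t p D g f) (hL κ Φ t p D g f) : ℕ) : ℤ) * (arrLoY3 κ Φ t p D g f mk 1 - kgSL (nL κ Φ t p D g f) (ℓL κ Φ t p D g f) (hL κ Φ t p D g f))) = vL κ Φ t p D g f * (((shearUnit (nL κ Φ t p D g f) (hL κ Φ t p D g f) : ℕ) : ℤ) * arrLoY3 κ Φ t p D g f mk 1) + (-vL κ Φ t p D g f) * (((shearUnit (nL κ Φ t p D g f) (hL κ Φ t p D g f) : ℕ) : ℤ) * kgSL (nL κ Φ t p D g f) (ℓL κ Φ t p D g f) (hL κ Φ t p D g f)) := by ring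
    have h2 : (-vL κ Φ t p D g f) * (((shearUnit (nL κ Φ t p D g f) (hL κ Φ t p D g f) : ℕ) : ℤ) * kgSL (nL κ Φ t p D g f) (ℓL κ Φ t p D g f) (hL κ Φ t p D g f)) ≤ |vL κ Φ t p D g f| * (((shearUnit (nL κ Φ t p D g f) (hL κ Φ t p D g f) : ℕ) : ℤ) * kgSL (nL κ Φ t p D g f) (ℓL κ Φ t p D g f) (hL κ Φ t p D g f)) := mul_le_mul_of_nonneg_right (neg_le_abs _) (mul_nonneg hU0 hs0)
    rw [e1]; linarith [le_max_left (vL κ Φ t p D g f * (((shearUnit (nL κ Φ t p D g f) (hL κ Φ t p D g f) : ℕ) : ℤ) * arrLoY3 κ Φ t p D g f mk 1)) (vL κ Φ t p D g f * (((shearUnit (nL κ Φ t p D g f) (hL κ Φ t p D g f) : ℕ) : ℤ) * arrHiY3 κ Φ t p D g f mk 1 + ((shearUnit (nL κ Φ t p D g f) (hL κ Φ t p D g f) : ℕ) : ℤ) - 1))]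
  have hT2 : vL κ Φ t p D g f * (((shearUnit (nL κ Φ t p D g f) (hL κ Φ t p D g f) : ℕ) : ℤ) * (arrHiY3 κ Φ t p D g f mk 1 + 1) + ((shearUnit (nL κ Φ t p D g f) (hL κ Φ t p D g f) : ℕ) : ℤ) - 1) ≤ max (vL κ Φ t p D g f * (((shearUnit (nL κ Φ t p D g f) (hL κ Φ t p D g f) : ℕ) : ℤ) * arrLoY3 κ Φ t p D g f mk 1)) (vL κ Φ t p D g f * (((shearUnit (nL κ Φ t p D g f) (hL κ Φ t p D g f) : ℕ) : ℤ) * arrHiY3 κ Φ t p D g f mk 1 + ((shearUnit (nL κ Φ t p D g f) (hL κ Φ t p D g f) : ℕ) : ℤ) - 1)) + (nL κ Φ t p D g f : ℤ) * modulus (nL κ Φ t p D g f) (hL κ Φ t p D g f) (vL κ Φ t p D g f) (vβL κ Φ t p D g f) := by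
    have e1 : vL κ Φ t p D g f * (((shearUnit (nL κ Φ t p D g f) (hL κ Φ t p D g f) : ℕ) : ℤ) * (arrHiY3 κ Φ t p D g f mk 1 + 1) + ((shearUnit (nL κ Φ t p D g f) (hL κ Φ t p D g f) : ℕ) : ℤ) - 1) = vL κ Φ t p D g f * (((shearUnit (nL κ Φ t p D g f) (hL κ Φ t p D g f) : ℕ) : ℤ) * arrHiY3 κ Φ t p D g f mk 1 + ((shearUnit (nL κ Φ t p D g f) (hL κ Φ t p D g f) : ℕ) : ℤ) - 1) + vL κ Φ t p D g f * ((shearUnit (nL κ Φ t p D g f) (hL κ Φ t p D g f) : ℕ) : ℤ) := by ring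
    have h2 : vL κ Φ t p D g f * ((shearUnit (nL κ Φ t p D g f) (hL κ Φ t p D g f) : ℕ) : ℤ) ≤ |vL κ Φ t p D g f| * ((shearUnit (nL κ Φ t p D g f) (hL κ Φ t p D g f) : ℕ) : ℤ) := mul_le_mul_of_nonneg_right (le_abs_self _) hU0
    rw [e1]; linarith [le_max_right (vL κ Φ t p D g f * (((shearUnit (nL κ Φ t p D g f) (hL κ Φ t p D g f) : ℕ) : ℤ) * arrLoY3 κ Φ t p D g f mk 1)) (vL κ Φ t p D g f * (((shearUnit (nL κ Φ t p D g f) (hL κ Φ t p D g f) : ℕ) : ℤ) * arrHiY3 κ Φ t p D g f mk 1 + ((shearUnit (nL κ Φ t p D g f) (hL κ Φ t p D g f) : ℕ) : ℤ) - 1))]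
  have hMX : max (vL κ Φ t p D g f * (((shearUnit (nL κ Φ t p D g f) (hL κ Φ t p D g f) : ℕ) : ℤ) * (arrLoY3 κ Φ t p D g f mk 1 - kgSL (nL κ Φ t p D g f) (ℓL κ Φ t p D g f) (hL κ Φ t p D g f)))) (vL κ Φ t p D g f * (((shearUnit (nL κ Φ t p D g f) (hL κ Φ t p D g f) : ℕ) : ℤ) * (arrHiY3 κ Φ t p D g f mk 1 + 1) + ((shearUnit (nL κ Φ t p D g f) (hL κ Φ t p D g f) : ℕ) : ℤ) - 1)) ≤ max (vL κ Φ t p D g f * (((shearUnit (nL κ Φ t p D g f) (hL κ Φ t p D g f) : ℕ) : ℤ) * arrLoY3 κ Φ t p D g f mk 1)) (vL κ Φ t p D g f * (((shearUnit (nL κ Φ t p D g f) (hL κ Φ t p D g f) : ℕ) : ℤ) * arrHiY3 κ Φ t p D g f mk 1 + ((shearUnit (nL κ Φ t p D g f) (hL κ Φ t p D g f) : ℕ) : ℤ) - 1)) + (nL κ Φ t p D g f : ℤ) * modulus (nL κ Φ t p D g f) (hL κ Φ t p D g f) (vL κ Φ t p D g f) (vβL κ Φ t p D g f) := max_le hT1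 hT2
  have hT3 : min (vL κ Φ t p D g f * (((shearUnit (nL κ Φ t p D g f) (hL κ Φ t p D g f) : ℕ) : ℤ) * arrLoY3 κ Φ t p D g f mk 1)) (vL κ Φ t p D g f * (((shearUnit (nL κ Φ t p D g f) (hL κ Φ t p D g f) : ℕ) : ℤ) * arrHiY3 κ Φ t p D g f mk 1 + ((shearUnit (nL κ Φ t p D g f) (hL κ Φ t p D g f) : ℕ) : ℤ) - 1)) - (nL κ Φ t p D g f : ℤ) * modulus (nL κ Φ t p D g f) (hL κ Φ t p D g f) (vL κ Φ t p D g f) (vβL κ Φ t p D g f) ≤ vL κ Φ t p D g f * (((shearUnit (nL κ Φ t p D g f) (hL κ Φ t p D g f) : ℕ) : ℤ) * (arrLoY3 κ Φ t p D g f mk 1 - kgSL (nL κ Φ t p D g f) (ℓL κ Φ t p D g f) (hL κ Φ t p D g f))) := by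
    have e1 : vL κ Φ t p D g f * (((shearUnit (nL κ Φ t p D g f) (hL κ Φ t p D g f) : ℕ) : ℤ) * (arrLoY3 κ Φ t p D g f mk 1 - kgSL (nL κ Φ t p D g f) (ℓL κ Φ t p D g f) (hL κ Φ t p D g f))) = vL κ Φ t p D g f * (((shearUnit (nL κ Φ t p D g f) (hL κ Φ t p D g f) : ℕ) : ℤ) * arrLoY3 κ Φ t p D g f mk 1) - vL κ Φ t p D g f * (((shearUnit (nL κ Φ t p D g f) (hL κ Φ t p D g f) : ℕ) : ℤ) * kgSL (nL κ Φ t p D g f) (ℓL κ Φ t p D g f) (hL κ Φ t p D g f)) := by ring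
    have h2 : vL κ Φ t p D g f * (((shearUnit (nL κ Φ t p D g f) (hL κ Φ t p D g f) : ℕ) : ℤ) * kgSL (nL κ Φ t p D g f) (ℓL κ Φ t p D g f) (hL κ Φ t p D g f)) ≤ |vL κ Φ t p D g f| * (((shearUnit (nL κ Φ t p D g f) (hL κ Φ t p D g f) : ℕ) : ℤ) * kgSL (nL κ Φ t p D g f) (ℓL κ Φ t p D g f) (hL κ Φ t p D g f)) := mul_le_mul_of_nonneg_right (le_abs_self _) (mul_nonneg hU0 hs0)
    rw [e1]; linarith [min_le_left (vL κ Φ t p D g f * (((shearUnit (nL κ Φ t p D g f) (hL κ Φ t p D g f) : ℕ) : ℤ) * arrLoY3 κ Φ t p D g f mk 1)) (vL κ Φ t p D g f * (((shearUnit (nL κ Φ t p D g f) (hL κ Φ t p D g f) : ℕ) : ℤ) * arrHiY3 κ Φ t p D g f mk 1 + ((shearUnit (nL κ Φ t p D g f) (hL κ Φ t p D g f) : ℕ) : ℤ) - 1))]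
  have hT4 : min (vL κ Φ t p D g f * (((shearUnit (nL κ Φ t p D g f) (hL κ Φ t p D g f) : ℕ) : ℤ) * arrLoY3 κ Φ t p D g f mk 1)) (vL κ Φ t p D g f * (((shearUnit (nL κ Φ t p D g f) (hL κ Φ t p D g f) : ℕ) : ℤ) * arrHiY3 κ Φ t p D g f mk 1 + ((shearUnit (nL κ Φ t p D g f) (hL κ Φ t p D g f) : ℕ) : ℤ) - 1)) - (nL κ Φ t p D g f : ℤ) * modulus (nL κ Φ t p D g f) (hL κ Φ t p D g f) (vL κ Φ t p D g f) (vβL κ Φ t p D g f) ≤ vL κ Φ t p D g f * (((shearUnit (nL κ Φ t p D g f) (hL κ Φ t p D g f) : ℕ) : ℤ) * (arrHiY3 κ Φ t p D g f mk 1 + 1) + ((shearUnit (nL κ Φ t p D g f) (hL κ Φ t p D g f) : ℕ) : ℤ) - 1) := by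
    have e1 : vL κ Φ t p D g f * (((shearUnit (nL κ Φ t p D g f) (hL κ Φ t p D g f) : ℕ) : ℤ) * (arrHiY3 κ Φ t p D g f mk 1 + 1) + ((shearUnit (nL κ Φ t p D g f) (hL κ Φ t p D g f) : ℕ) : ℤ) - 1) = vL κ Φ t p D g f * (((shearUnit (nL κ Φ t p D g f) (hL κ Φ t p D g f) : ℕ) : ℤ) * arrHiY3 κ Φ t p D g f mk 1 + ((shearUnit (nL κ Φ t p D g f) (hL κ Φ t p D g f) : ℕ) : ℤ) - 1) + vL κ Φ t p D g f * ((shearUnit (nL κ Φ t p D g f) (hL κ Φ t p D g f) : ℕ) : ℤ) := by ring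
    have h2 : -(vL κ Φ t p D g f * ((shearUnit (nL κ Φ t p D g f) (hL κ Φ t p D g f) : ℕ) : ℤ)) ≤ |vL κ Φ t p D g f| * ((shearUnit (nL κ Φ t p D g f) (hL κ Φ t p D g f) : ℕ) : ℤ) := by rw [← neg_mul]; exact mul_le_mul_of_nonneg_right (neg_le_abs _) hU0
    rw [e1]; linarith [min_le_right (vL κ Φ t p D g f * (((shearUnit (nL κ Φ t p D g f) (hL κ Φ t p D g f) : ℕ) : ℤ) * arrLoY3 κ Φ t p D g f mk 1)) (vL κ Φ t p D g f * (((shearUnit (nL κ Φ t p D g f) (hL κ Φ t p D g f) : ℕ) : ℤ) * arrHiY3 κ Φ t p D g f mk 1 + ((shearUnit (nL κ Φ t p D g f) (hL κ Φ t p D g f) : ℕ) : ℤ) - 1))]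
  have hMN : min (vL κ Φ t p D g f * (((shearUnit (nL κ Φ t p D g f) (hL κ Φ t p D g f) : ℕ) : ℤ) * arrLoY3 κ Φ t p D g f mk 1)) (vL κ Φ t p D g f * (((shearUnit (nL κ Φ t p D g f) (hL κ Φ t p D g f) : ℕ) : ℤ) * arrHiY3 κ Φ t p D g f mk 1 + ((shearUnit (nL κ Φ t p D g f) (hL κ Φ t p D g f) : ℕ) : ℤ) - 1)) - (nL κ Φ t p D g f : ℤ) * modulus (nL κ Φ t p D g f) (hL κ Φ t p D g f) (vL κ Φ t p D g f) (vβL κ Φ t p D g f) ≤ min (vL κ Φ t p D g f * (((shearUnit (nL κ Φ t p D g f) (hL κ Φ t p D g f) : ℕ) : ℤ) * (arrLoY3 κ Φ t p D g f mk 1 - kgSL (nL κ Φ t p D g f) (ℓL κ Φ t p D g f) (hL κ Φ t p D g f)))) (vL κ Φ t p D g f * (((shearUnit (nL κ Φ t p D g f) (hL κ Φ t p D g f) : ℕ) : ℤ) * (arrHiY3 κ Φ t p D g f mk 1 + 1) + ((shearUnit (nL κ Φ t p D g f) (hL κ Φ t p D g f) : ℕ) : ℤ) - 1)) := le_min hT3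 hT4
  constructor
  · have hk : (prFA κ Φ t p D g f).c₀ * (Aof κ * (3 * modulus (nL κ Φ t p D g f) (hL κ Φ t p D g f) (vL κ Φ t p D g f) (vβL κ Φ t p D g f))) = (3 * (((fcellsA κ Φ t p D g f).s 0 : ℕ) : ℤ)) * (prFA κ Φ t p D g f).D := by linear_combination 3 * e0
    have hsh := rdLo_zero_widen (lo := arrLoY3 κ Φ t p D g f mk) (hi := arrHiY3 κ Φ t p D g f mk) (lo' := (![arrLoY3 κ Φ t p D g f mk 0 - 2 * (nL κ Φ t p D g f : ℤ), arrLoY3 κ Φ t p D g f mk 1 - kgSL (nL κ Φ t p D g f) (ℓL κ Φ t p D g f) (hL κ Φ t p D g f)] : Site 2)) (hi' := (![arrHiY3 κ Φ t p D g f mk 0 + (nL κ Φ t p D g f : ℤ), arrHiY3 κ Φ t p D g f mk 1 + 1] : Site 2))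
      (A := Aof κ) (n := nL κ Φ t p D g f) (h := hL κ Φ t p D g f) (vα := vL κ Φ t p D g f) (vβ := vβL κ Φ t p D g f) (c₀' := (prFA κ Φ t p D g f).c₀) (c₁' := (prFA κ Φ t p D g f).c₁) (D := (prFA κ Φ t p D g f).D)
      (e := 3 * modulus (nL κ Φ t p D g f) (hL κ Φ t p D g f) (vL κ Φ t p D g f) (vβL κ Φ t p D g f)) (k := 3 * (((fcellsA κ Φ t p D g f).s 0 : ℕ) : ℤ)) hn1 hA0.le hDp hc₀.le ?_ hk
    · rw [hc, hb0]; unfold cmidY3; omega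
    · simp only [Matrix.cons_val_zero, Matrix.cons_val_one]
      have e1 : modulus (nL κ Φ t p D g f) (hL κ Φ t p D g f) (vL κ Φ t p D g f) (vβL κ Φ t p D g f) * (arrLoY3 κ Φ t p D g f mk 0 - 2 * (nL κ Φ t p D g f : ℤ)) = modulus (nL κ Φ t p D g f) (hL κ Φ t p D g f) (vL κ Φ t p D g f) (vβL κ Φ t p D g f) * arrLoY3 κ Φ t p D g f mk 0 - 2 * ((nL κ Φ t p D g f : ℤ) * modulus (nL κ Φ t p D g f) (hL κ Φ t p D g f) (vL κ Φ t p D g f) (vβL κ Φ t p D g f)) := by ring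
      have e2 : ((nL κ Φ t p D g f : ℤ) : ℤ) * (3 * modulus (nL κ Φ t p D g f) (hL κ Φ t p D g f) (vL κ Φ t p D g f) (vβL κ Φ t p D g f)) = 3 * ((nL κ Φ t p D g f : ℤ) * modulus (nL κ Φ t p D g f) (hL κ Φ t p D g f) (vL κ Φ t p D g f) (vβL κ Φ t p D g f)) := by ring
      rw [e1, e2]; linarith
  · have hk : (prFA κ Φ t p D g f).c₀ * (Aof κ * (2 * modulus (nL κ Φ t p D g f) (hL κ Φ t p D g f) (vL κ Φ t p D g f) (vβL κ Φ t p D g f))) = (2 * (((fcellsA κ Φ t p D g f).s 0 : ℕ) : ℤ)) * (prFA κ Φ t p D g f).D := by linear_combination 2 * e0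
    have hsh := rdHi_zero_widen (lo := arrLoY3 κ Φ t p D g f mk) (hi := arrHiY3 κ Φ t p D g f mk) (lo' := (![arrLoY3 κ Φ t p D g f mk 0 - 2 * (nL κ Φ t p D g f : ℤ), arrLoY3 κ Φ t p D g f mk 1 - kgSL (nL κ Φ t p D g f) (ℓL κ Φ t p D g f) (hL κ Φ t p D g f)] : Site 2)) (hi' := (![arrHiY3 κ Φ t p D g f mk 0 + (nL κ Φ t p D g f : ℤ), arrHiY3 κ Φ t p D g f mk 1 + 1] : Site 2))
      (A := Aof κ) (n := nL κ Φ t p D g f) (h := hL κ Φ t p D g f) (vα := vL κ Φ t p D g f) (vβ := vβL κ Φ t p D g f) (c₀' := (prFA κ Φ t p D g f).c₀) (c₁' := (prFA κ Φ t p D g f).c₁) (D := (prFA κ Φ t p D g f).D)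
      (e := 2 * modulus (nL κ Φ t p D g f) (hL κ Φ t p D g f) (vL κ Φ t p D g f) (vβL κ Φ t p D g f)) (k := 2 * (((fcellsA κ Φ t p D g f).s 0 : ℕ) : ℤ)) hn1 hA0.le hDp hc₀.le ?_ hk
    · rw [hc, hb0]; unfold cmidY3; omega
    · simp only [Matrix.cons_val_zero, Matrix.cons_val_one]
      have e1 : modulus (nL κ Φ t p D g f) (hL κ Φ t p D g f) (vL κ Φ t p D g f) (vβL κ Φ t p D g f) * (arrHiY3 κ Φ t p D g f mk 0 + (nL κ Φ t p D g f : ℤ)) = modulus (nL κ Φ t p D g f) (hL κ Φ t p D g f) (vL κ Φ t p D g f) (vβL κ Φ t p D g f) * arrHiY3 κ Φ t p D g f mk 0 + (nL κ Φ t p D g f : ℤ) * modulus (nL κ Φ t p D g f) (hL κ Φ t p D g f) (vL κ Φ t p D g f) (vβL κ Φ t p D g f) := by ring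
      have e2 : ((nL κ Φ t p D g f : ℤ) : ℤ) * (2 * modulus (nL κ Φ t p D g f) (hL κ Φ t p D g f) (vL κ Φ t p D g f) (vβL κ Φ t p D g f)) = 2 * ((nL κ Φ t p D g f : ℤ) * modulus (nL κ Φ t p D g f) (hL κ Φ t p D g f) (vL κ Φ t p D g f) (vβL κ Φ t p D g f)) := by ring
      rw [e1, e2]; linarith

/-- **(R-YA) THE WIDENED ROOT y′ ARRIVAL BOX READS INSIDE `TargetFoot (1,true)` at `b = small3`, creep `c1 = cRvY3 mk`** (p3-g18's `hrow` of `KS.hlastf_RY`,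
box = `KS.yLast_mem_box`'s `kgLastLoY/HiY − (2n_L, sL) / + (n_L, 1)` at the (C) rows `kgYRows0_of … qxYQ4 WxYQ4`, `N := kgNYv0`, by `rfl` = `arrLoY3/arrHiY3`).
[this work] -/
theorem rootReadYA_Q (hKq : 5 ≤ Neg.Kq κ) (hN : EqNumL κ Φ t p D g f) (hg : gFloorKG κ Φ t p D mk ≤ g) (hg2 : 40 * Neg.K κ * KS0.R'0 κ Φ t p D mk ≤ g) :
    ((cRvY3 κ Φ t p D g f mk : ℕ) : ℤ) - ((BSlot.small3 κ Φ t p D g f 0 : ℕ) : ℤ) + 1 ≤ rdLo (Aof κ) (nL κ Φ t p D g f) (hL κ Φ t p D g f) (vL κ Φ t p D g f) (vβL κ Φ t p D g f) (prFA κ Φ t p D g f).c₀ (prFA κ Φ t p D g f).c₁ (prFA κ Φ t p D g f).D (![arrLoY3 κ Φ t p D g f mk 0 - 2 * (nL κ Φ t p D g f : ℤ), arrLoY3 κ Φ t p D g f mk 1 - kgSL (nL κ Φ t p D g f) (ℓL κ Φ t p D g f) (hL κ Φ t p D g f)] : Site 2) (![arrHiY3 κ Φ t p D g f mk 0 + (nL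 κ Φ t p D g f : ℤ), arrHiY3 κ Φ t p D g f mk 1 + 1] : Site 2) 0 ∧ rdHi (Aof κ) (nL κ Φ t p D g f) (hL κ Φ t p D g f) (vL κ Φ t p D g f) (vβL κ Φ t p D g f) (prFA κ Φ t p D g f).c₀ (prFA κ Φ t p D g f).c₁ (prFA κ Φ t p D g f).D (![arrLoY3 κ Φ t p D g f mk 0 - 2 * (nL κ Φ t p D g f : ℤ), arrLoY3 κ Φ t p D g f mk 1 - kgSL (nL κ Φ t p D g f) (ℓL κ Φ t p D g f) (hL κ Φ t p D g f)] : Site 2) (![arrHiY3 κ Φ t p D g f mk 0 + (nL κ Φ t p D g f : ℤ), arrHiY3 κ Φ t p D g f mk 1 + 1] : Site 2) 0 ≤ ((cRvY3 κ Φ t p D g f mk : ℕ) : ℤ) + ((BSlot.small3 κ Φ t p D g f 0 : ℕ) : ℤ) - 1 ∧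
      20 * (((fcellsA κ Φ t p D g f).r 1 : ℕ) : ℤ) - ((BSlot.small3 κ Φ t p D g f 1 : ℕ) : ℤ) + 1 ≤ rdLo (Aof κ) (nL κ Φ t p D g f) (hL κ Φ t p D g f) (vL κ Φ t p D g f) (vβL κ Φ t p D g f) (prFA κ Φ t p D g f).c₀ (prFA κ Φ t p D g f).c₁ (prFA κ Φ t p D g f).D (![arrLoY3 κ Φ t p D g f mk 0 - 2 * (nL κ Φ t p D g f : ℤ), arrLoY3 κ Φ t p D g f mk 1 - kgSL (nL κ Φ t p D g f) (ℓL κ Φ t p D g f) (hL κ Φ t p D g f)] : Site 2) (![arrHiY3 κ Φ t p D g f mk 0 + (nL κ Φ t p D g f : ℤ), arrHiY3 κ Φ t p D g f mk 1 + 1] : Site 2) 1 ∧ rdHi (Aof κ) (nL κ Φ t p D g f) (hL κ Φ t p D g f) (vL κ Φ t p D g f) (vβL κ Φ t p D g f) (prFA κ Φ t p D g f).c₀ (prFA κ Φ t p D g f).c₁ (prFA κ Φ t p D g f).D (![arrLoY3 κ Φ t p D g f mk 0 - 2 * (nL κ Φ t p D g f : ℤ), arrLoY3 κ Φ t p D g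 f mk 1 - kgSL (nL κ Φ t p D g f) (ℓL κ Φ t p D g f) (hL κ Φ t p D g f)] : Site 2) (![arrHiY3 κ Φ t p D g f mk 0 + (nL κ Φ t p D g f : ℤ), arrHiY3 κ Φ t p D g f mk 1 + 1] : Site 2) 1 ≤ 20 * (((fcellsA κ Φ t p D g f).r 1 : ℕ) : ℤ) + ((BSlot.small3 κ Φ t p D g f 1 : ℕ) : ℤ) - 1 := by
  obtain ⟨h1, h2⟩ := rootReadYA_across κ Φ t p D g f mk hKq hN hg hg2
  obtain ⟨h3, h4⟩ := rootReadYA_rows κ Φ t p D g f mk hKq hN hg hg2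
  exact ⟨h1, h2, h3, h4⟩

end RootYA

end NegB

end PlanarSkeletonFrm

end Summit.CriticalPhenomena.PercolationContinuityZ3.Theorems.Transplant

end
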